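import Mathlib
import Summits.ValiantsHypothesis.ValiantsHypothesis.Theorems.KPlusLogSqLawStaticTridiagonalCancellationBorn

/-!
# The envelope-count lifting law is false for EVERY constant: block sums of the cancellation witness at separated scales

HONEST FRAMING.  Helper (seat val-sym-lift-p2 g8, cell `pub-symmetroid`, 2026-08-27; desk R2114 (A)(a), pre-registered words «ENVELOPE-COUNT
LAW FALSE FOR EVERY c») for the REAL side of the crux `WeakLifting` (stmt-ValiantsHypothesis-19561), static tridiagonal sector.  A NEGATIVE
datum about a lifting MECHANISM; nothing here bears on `WeakLifting` / `TropicalB` / Conjecture B in their windows, the typed α target's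
linear family, the Door-A registers, `MatrixDescartes` (stmt-ValiantsHypothesis-18050) or VP ≠ VNP.  Label: calibration (target repair).

WHAT IS PROVED.  Let `T(X)` be the `8 × 8` witness of `…StaticTridiagonalCancellationBorn` (`det T = p`, `p = 6⁸ − 1166400X² − 1131408X⁴ −
1093500X⁶ + 6⁸X⁸`: flat Newton chord at height `6⁸`, the three other coefficients negative and strictly below it, two positive zeros).  The
block sums `T_r(X) = diag(T(X), T(X⁹), T(X⁸¹), …, T(X^{9^{r−1}}))` are again STATIC SYMMETRIC TRIDIAGONAL monomial pencils (size `8r`, zero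
links between the blocks), and `det T_r = Q_r := ∏_{i<r} p(X^{9^i})` (kernel: `Q_{r+1} = p · Q_r(X⁹)`, an iterate).  Because `deg p = 8 < 9`,
the coefficients of `Q_r` READ DIGITS: `Q_{r+1}.coeff n = p.coeff (n % 9) · Q_r.coeff (n / 9)` (`coeff_mul_expand_of_natDegree_lt`), whence
`Q_r.coeff 0 = Q_r.leadingCoeff = 6^{8r}`, every coefficient has modulus `≤ 6^{8r}`, and every NEGATIVE coefficient has modulus `< 6^{8r}`:
the upper Newton polygon of `Q_r` is FLAT and carries only positive coefficients (signed Newton count `0`), while `Q_r` vanishes at the `2r`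
distinct positive reals `ρ_a^{9^{−i}}` (`a = 1, 2`, `i < r`; `ρ₁ ∈ (1/2, 1)`, `ρ₂ ∈ (1, 2)` the two positive zeros of `p`).  Hence
(`not_envelopeCountLaw`): **for every `c : ℕ` it is FALSE that a static symmetric tridiagonal monomial pencil whose determinant has positive
extreme coefficients and all its negative coefficients strictly below their chord has at most `c` positive determinant zeros** — the law
«real count ≤ signed Newton count + c» fails on the sector for every `c` (excess `2r` against `r + 1` positive hull points, `m = 8r`,
`K = r + 1` exponent classes `0, 1, 9, …, 9^{r−1}`).  Any true real-vs-tropical law for the sector therefore needs additive slack `Ω(m)` or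
a factor `≥ 2` on the number of envelope points.
[folklore: digit-separated products, block determinants, intermediate value theorem; data of this seat]
-/

set_option linter.dupNamespace false
set_option autoImplicit false

namespace Summit.ValiantsHypothesis.ValiantsHypothesis.Theorems.KPlusLogSqLaw.TridiagonalSector

open Polynomial Finset Matrix

/-! ### Digit-separated products -/

/-- **digit lemma**: if `deg p < N`, the coefficients of `p · q(X^N)` read the base-`N` digits: `coeff n = p_(n % N) · q_(n / N)`. [folklore] -/
theorem coeff_mul_expand_of_natDegree_lt {R : Type*} [CommSemiring R] (p q : R[X]) {N : ℕ} (hN : 0 < N)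
    (hp : p.natDegree < N) (n : ℕ) :
    (p * expand R N q).coeff n = p.coeff (n % N) * q.coeff (n / N) := by
  rw [coeff_mul]
  have hmem : (n % N, N * (n / N)) ∈ antidiagonal n := by
    rw [Finset.HasAntidiagonal.mem_antidiagonal]; exact Nat.mod_add_div n N
  rw [sum_eq_single_of_mem _ hmem]
  · rw [coeff_expand hN, if_pos (Dvd.intro _ rfl), Nat.mul_div_cancel_left _ hN]
  · rintro ⟨a, b⟩ hab hne
    rw [Finset.HasAntidiagonal.mem_antidiagonal] at hab
    by_cases ha : N ≤ a
    · rw [coeff_eq_zero_of_natDegree_lt (lt_of_lt_of_le hp ha), zero_mul]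
    · push Not at ha
      rw [coeff_expand hN]
      split_ifs with hdvd
      · exfalso
        apply hne
        obtain ⟨t, rfl⟩ := hdvd
        have h1 : n % N = a := by
          rw [← hab, Nat.add_mul_mod_self_left, Nat.mod_eq_of_lt ha]
        have h2 : n / N = t := by
          rw [← hab, Nat.add_mul_div_left _ _ hN, Nat.div_eq_of_lt ha, zero_add]
        rw [h1, h2]
      · rw [mul_zero]

/-! ### The iterates `Q_r = (q ↦ p · q(X⁹))^[r] 1` -/

section Iterate

variable (p : ℝ[X]) (hp : p.natDegree < 9)
include hp

/-- coefficients of the next iterate read one more digit. [folklore] -/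
theorem iterate_coeff (r n : ℕ) :
    ((fun q => p * expand ℝ 9 q)^[r + 1] 1).coeff n =
      p.coeff (n % 9) * ((fun q => p * expand ℝ 9 q)^[r] 1).coeff (n / 9) := by
  rw [Function.iterate_succ_apply']
  exact coeff_mul_expand_of_natDegree_lt p _ (by norm_num) hp n

/-- the constant coefficient of `Q_r` is `p₀ ^ r`. [folklore] -/
theorem iterate_coeff_zero (r : ℕ) : ((fun q => p * expand ℝ 9 q)^[r] 1).coeff 0 = p.coeff 0 ^ r := by
  induction r with
  | zero => simp
  | succ r ih => rw [iterate_coeff p hp, Nat.zero_mod, Nat.zero_div, ih, pow_succ, mul_comm]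

/-- every coefficient of `Q_r` is at most `π ^ r` in modulus if every coefficient of `p` is at most `π`. [folklore] -/
theorem iterate_abs_coeff_le (π : ℝ) (hπ : ∀ a, |p.coeff a| ≤ π) (r : ℕ) :
    ∀ n, |((fun q => p * expand ℝ 9 q)^[r] 1).coeff n| ≤ π ^ r := by
  have hπ0 : 0 ≤ π := le_trans (abs_nonneg _) (hπ 0)
  induction r with
  | zero =>
    intro n
    simp only [Function.iterate_zero, id_eq, pow_zero, coeff_one]
    split_ifs <;> simp
  | succ r ih =>
    intro n
    rw [iterate_coeff p hp, abs_mul]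
    calc |p.coeff (n % 9)| * |((fun q => p * expand ℝ 9 q)^[r] 1).coeff (n / 9)| ≤ π * π ^ r :=
          mul_le_mul (hπ _) (ih _) (abs_nonneg _) hπ0
      _ = π ^ (r + 1) := by ring

/-- a NEGATIVE coefficient of `Q_r` is strictly below `π ^ r` in modulus, provided the negative coefficients of `p` are strictly below `π`.
[folklore] -/
theorem iterate_neg_coeff_lt (π : ℝ) (hπ : ∀ a, |p.coeff a| ≤ π) (hneg : ∀ a, p.coeff a < 0 → |p.coeff a| < π) (r : ℕ) :
    ∀ n, ((fun q => p * expand ℝ 9 q)^[r] 1).coeff n < 0 → |((fun q => p * expand ℝ 9 q)^[r] 1).coeff n| < π ^ r := by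
  have hπ0 : 0 ≤ π := le_trans (abs_nonneg _) (hπ 0)
  induction r with
  | zero =>
    intro n hn
    exfalso
    simp only [Function.iterate_zero, id_eq, coeff_one] at hn
    split_ifs at hn <;> norm_num at hn
  | succ r ih =>
    intro n hn
    rw [iterate_coeff p hp] at hn ⊢
    rw [abs_mul]
    rcases mul_neg_iff.mp hn with ⟨ha, hb⟩ | ⟨ha, hb⟩
    · have h1 := ih _ hb
      calc |p.coeff (n % 9)| * |((fun q => p * expand ℝ 9 q)^[r] 1).coeff (n / 9)|
          < |p.coeff (n % 9)| * π ^ r := mul_lt_mul_of_pos_left h1 (abs_pos.mpr ha.ne')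
        _ ≤ π * π ^ r := mul_le_mul_of_nonneg_right (hπ _) (pow_nonneg hπ0 _)
        _ = π ^ (r + 1) := by ring
    · have h1 := hneg _ ha
      have h2 := iterate_abs_coeff_le p hp π hπ r (n / 9)
      calc |p.coeff (n % 9)| * |((fun q => p * expand ℝ 9 q)^[r] 1).coeff (n / 9)|
          < π * |((fun q => p * expand ℝ 9 q)^[r] 1).coeff (n / 9)| := mul_lt_mul_of_pos_right h1 (abs_pos.mpr hb.ne')
        _ ≤ π * π ^ r := mul_le_mul_of_nonneg_left h2 hπ0
        _ = π ^ (r + 1) := by ring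

omit hp in
/-- leading coefficient of `Q_r`. [folklore] -/
theorem iterate_leadingCoeff (r : ℕ) : ((fun q => p * expand ℝ 9 q)^[r] 1).leadingCoeff = p.leadingCoeff ^ r := by
  induction r with
  | zero => simp
  | succ r ih =>
    rw [Function.iterate_succ_apply', leadingCoeff_mul, leadingCoeff_expand (by norm_num), ih, pow_succ, mul_comm]

omit hp in
/-- roots of `Q_r`: every `x` with `p(x^{9^i}) = 0` for some `i < r`. [folklore] -/
theorem iterate_eval_eq_zero (r : ℕ) :
    ∀ x : ℝ, (∃ i, i < r ∧ p.eval (x ^ 9 ^ i) = 0) → ((fun q => p * expand ℝ 9 q)^[r] 1).eval x = 0 := by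
  induction r with
  | zero => rintro x ⟨i, hi, -⟩; omega
  | succ r ih =>
    rintro x ⟨i, hi, hx⟩
    rw [Function.iterate_succ_apply', eval_mul, expand_eval]
    cases i with
    | zero =>
      rw [pow_zero, pow_one] at hx
      rw [hx, zero_mul]
    | succ j =>
      have hj : j < r := by omega
      have : ((fun q => p * expand ℝ 9 q)^[r] 1).eval (x ^ 9) = 0 :=
        ih (x ^ 9) ⟨j, hj, by rw [← pow_mul, ← pow_succ']; exact hx⟩
      rw [this, mul_zero]

end Iterate

/-! ### The block family (existential induction on the number of blocks) -/

/-- **block sums of the witness are static symmetric tridiagonal monomial pencils with determinant `Q_r`.**  For every `r` there is a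
symmetric tridiagonal matrix of monomials `C (c i j) · X ^ (e i j)` (size `8r`; the blocks `T(X^{9^k})`, zero links between them) whose
determinant is the iterate `Q_r = (q ↦ p · q(X⁹))^[r] 1` of the witness determinant `p`. [folklore: block determinants] -/
theorem exists_blockSum_det_eq_iterate (r : ℕ) :
    ∃ (m : ℕ) (c : Fin m → Fin m → ℝ) (e : Fin m → Fin m → ℕ), (∀ i j, c i j = c j i) ∧ (∀ i j, e i j = e j i) ∧
      (∀ i j : Fin m, (i : ℕ) + 1 < j ∨ (j : ℕ) + 1 < i → c i j = 0) ∧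
      (Matrix.det (Matrix.of fun i j => C (c i j) * (X : ℝ[X]) ^ e i j)) =
        (fun q => (C 1679616 - C 1166400 * X ^ 2 - C 1131408 * X ^ 4 - C 1093500 * X ^ 6 + C 1679616 * X ^ 8 : ℝ[X]) *
          expand ℝ 9 q)^[r] 1 := by
  induction r with
  | zero =>
    refine ⟨0, fun _ _ => 0, fun _ _ => 0, fun i => i.elim0, fun i => i.elim0, fun i => i.elim0, ?_⟩
    simp [Matrix.det_isEmpty]
  | succ r ih =>
    obtain ⟨m, c, e, hcs, hes, hband, hdet⟩ := ih
    -- the witness block and its letters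
    let c8 : Fin 8 → Fin 8 → ℝ := fun i j =>
      if (i : ℕ) = j then (if (i : ℕ) = 3 ∨ (i : ℕ) = 4 ∨ (i : ℕ) = 6 ∨ (i : ℕ) = 7 then (-6 : ℝ) else 6)
      else if (j : ℕ) = i + 1 then (if (i : ℕ) = 1 ∨ (i : ℕ) = 5 then (3 : ℝ) else if (i : ℕ) = 3 then 5 else 6)
      else if (i : ℕ) = j + 1 then (if (j : ℕ) = 1 ∨ (j : ℕ) = 5 then (3 : ℝ) else if (j : ℕ) = 3 then 5 else 6)
      else 0
    let e8 : Fin 8 → Fin 8 → ℕ := fun i j => if (i : ℕ) = j then 0 else 1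
    have hc8s : ∀ i j, c8 i j = c8 j i := by intro i j; fin_cases i <;> fin_cases j <;> simp [c8]
    have he8s : ∀ i j, e8 i j = e8 j i := by
      intro i j
      by_cases h : (i : ℕ) = j
      · simp [e8, h]
      · have h' : (j : ℕ) ≠ i := fun h'' => h h''.symm
        simp [e8, h, h']
    have hc8b : ∀ i j : Fin 8, (i : ℕ) + 1 < j ∨ (j : ℕ) + 1 < i → c8 i j = 0 := by
      intro i j hij
      have h1 : (i : ℕ) ≠ j := by omega
      have h2 : (j : ℕ) ≠ i + 1 := by omega
      have h3 : (i : ℕ) ≠ j + 1 := by omega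
      simp only [c8, h1, h2, h3, if_false]
    -- glue along `Fin 8 ⊕ Fin m ≃ Fin (8 + m)`
    let E : Fin 8 ⊕ Fin m ≃ Fin (8 + m) := finSumFinEquiv
    let c' : Fin (8 + m) → Fin (8 + m) → ℝ := fun i j =>
      Sum.elim (fun a => Sum.elim (fun b => c8 a b) (fun _ => 0) (E.symm j))
        (fun a => Sum.elim (fun _ => 0) (fun b => c a b) (E.symm j)) (E.symm i)
    let e' : Fin (8 + m) → Fin (8 + m) → ℕ := fun i j =>
      Sum.elim (fun a => Sum.elim (fun b => e8 a b) (fun _ => 0) (E.symm j))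
        (fun a => Sum.elim (fun _ => 0) (fun b => 9 * e a b) (E.symm j)) (E.symm i)
    have hval_inl : ∀ (i : Fin (8 + m)) (a : Fin 8), E.symm i = Sum.inl a → (i : ℕ) = a := by
      intro i a h
      have : i = E (Sum.inl a) := by rw [← h, Equiv.apply_symm_apply]
      rw [this]; simp [E]
    have hval_inr : ∀ (i : Fin (8 + m)) (a : Fin m), E.symm i = Sum.inr a → (i : ℕ) = 8 + a := by
      intro i a h
      have : i = E (Sum.inr a) := by rw [← h, Equiv.apply_symm_apply]
      rw [this]; simp [E]
    refine ⟨8 + m, c', e', ?_, ?_, ?_, ?_⟩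
    · intro i j
      rcases hi : E.symm i with a | a <;> rcases hj : E.symm j with b | b <;> simp [c', hi, hj, hc8s, hcs]
    · intro i j
      rcases hi : E.symm i with a | a <;> rcases hj : E.symm j with b | b <;> simp [e', hi, hj, he8s, hes]
    · intro i j hij
      rcases hi : E.symm i with a | a <;> rcases hj : E.symm j with b | b
      · have h1 := hval_inl i a hi
        have h2 := hval_inl j b hj
        simp only [c', hi, hj, Sum.elim_inl]
        exact hc8b a b (by omega)
      · simp [c', hi, hj]
      · simp [c', hi, hj]
      · have h1 := hval_inr i a hi
        have h2 := hval_inr j b hj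
        simp only [c', hi, hj, Sum.elim_inr]
        exact hband a b (by omega)
    · -- determinant: reindexed block-diagonal matrix
      let T8 : Matrix (Fin 8) (Fin 8) ℝ[X] := Matrix.of fun a b => C (c8 a b) * (X : ℝ[X]) ^ e8 a b
      let M : Matrix (Fin m) (Fin m) ℝ[X] := Matrix.of fun a b => C (c a b) * (X : ℝ[X]) ^ e a b
      let D : Matrix (Fin m) (Fin m) ℝ[X] := Matrix.of fun a b => C (c a b) * (X : ℝ[X]) ^ (9 * e a b)
      have hglue : (Matrix.of fun i j => C (c' i j) * (X : ℝ[X]) ^ e' i j) =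
          Matrix.reindex E E (Matrix.fromBlocks T8 0 0 D) := by
        ext i j
        rw [Matrix.reindex_apply, Matrix.submatrix_apply, Matrix.of_apply]
        rcases hi : E.symm i with a | a <;> rcases hj : E.symm j with b | b <;>
          simp [c', e', T8, D, hi, hj, Matrix.fromBlocks_apply₁₁, Matrix.fromBlocks_apply₁₂, Matrix.fromBlocks_apply₂₁,
            Matrix.fromBlocks_apply₂₂]
      have hD : D = (expand ℝ 9 : ℝ[X] →ₐ[ℝ] ℝ[X]).toRingHom.mapMatrix M := by
        ext a b
        simp only [D, M, RingHom.mapMatrix_apply, Matrix.map_apply, Matrix.of_apply, AlgHom.toRingHom_eq_coe,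
          RingHom.coe_coe, map_mul, map_pow, expand_C, expand_X, pow_mul]
      have hdetD : D.det = expand ℝ 9 M.det := by
        rw [hD, ← RingHom.map_det]
        rfl
      have hT8 : T8.det = C 1679616 - C 1166400 * X ^ 2 - C 1131408 * X ^ 4 - C 1093500 * X ^ 6 + C 1679616 * X ^ 8 :=
        det_cancellationWitness
      rw [hglue, Matrix.det_reindex_self, Matrix.det_fromBlocks_zero₂₁, hT8, hdetD]
      change _ = (fun q => (C 1679616 - C 1166400 * X ^ 2 - C 1131408 * X ^ 4 - C 1093500 * X ^ 6 + C 1679616 * X ^ 8 : ℝ[X]) *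
          expand ℝ 9 q)^[r + 1] 1
      rw [Function.iterate_succ_apply', ← hdet]

/-! ### The law is false for every constant -/

/-- **THE ENVELOPE-COUNT LAW IS FALSE FOR EVERY `c` (kernel).**  For every `c : ℕ` it is NOT the case that every static symmetric
tridiagonal matrix of monomials whose determinant `q` has positive extreme coefficients (`q.coeff 0`, `q.leadingCoeff`) and all its
NEGATIVE coefficients strictly below the chord of the extreme ones (`|q_k| ^ deg < q_0 ^ (deg − k) · lc ^ k`; hence an upper Newton polygon
without sign change) has at most `c` distinct positive determinant zeros: the block sum `diag(T(X), T(X⁹), …, T(X^{9^c}))` of the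
cancellation witness has `2(c + 1)` of them (at `ρ_a^{9^{-i}}`).  So «real count ≤ signed Newton-polygon count + c» fails on the static
tridiagonal sector for every `c`. [folklore: digit-separated products + IVT; data of this seat] -/
theorem not_envelopeCountLaw (cst : ℕ) :
    ¬ (∀ (m : ℕ) (c : Fin m → Fin m → ℝ) (e : Fin m → Fin m → ℕ), (∀ i j, c i j = c j i) → (∀ i j, e i j = e j i) →
        (∀ i j : Fin m, (i : ℕ) + 1 < j ∨ (j : ℕ) + 1 < i → c i j = 0) →
        0 < (Matrix.det (Matrix.of fun i j => C (c i j) * (X : ℝ[X]) ^ e i j)).coeff 0 →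
        0 < (Matrix.det (Matrix.of fun i j => C (c i j) * (X : ℝ[X]) ^ e i j)).leadingCoeff →
        (∀ k : ℕ, (Matrix.det (Matrix.of fun i j => C (c i j) * (X : ℝ[X]) ^ e i j)).coeff k < 0 →
          |(Matrix.det (Matrix.of fun i j => C (c i j) * (X : ℝ[X]) ^ e i j)).coeff k| ^
              (Matrix.det (Matrix.of fun i j => C (c i j) * (X : ℝ[X]) ^ e i j)).natDegree <
            (Matrix.det (Matrix.of fun i j => C (c i j) * (X : ℝ[X]) ^ e i j)).coeff 0 ^
                ((Matrix.det (Matrix.of fun i j => C (c i j) * (X : ℝ[X]) ^ e i j)).natDegree - k) *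
              (Matrix.det (Matrix.of fun i j => C (c i j) * (X : ℝ[X]) ^ e i j)).leadingCoeff ^ k) →
        ((Matrix.det (Matrix.of fun i j => C (c i j) * (X : ℝ[X]) ^ e i j)).roots.toFinset.filter
          (fun t : ℝ => 0 < t)).card ≤ cst) := by
  intro hlaw
  obtain ⟨m, c, e, hcs, hes, hband, hdet⟩ := exists_blockSum_det_eq_iterate (cst + 1)
  -- the base polynomial and its letters
  set p : ℝ[X] := C 1679616 - C 1166400 * X ^ 2 - C 1131408 * X ^ 4 - C 1093500 * X ^ 6 + C 1679616 * X ^ 8 with hp_def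
  set Q : ℝ[X] := (fun q => p * expand ℝ 9 q)^[cst + 1] 1 with hQ_def
  have hdet' : Matrix.det (Matrix.of fun i j => C (c i j) * (X : ℝ[X]) ^ e i j) = Q := hdet
  obtain ⟨hdeg8, hlc8⟩ := natDegree_cancellationWitness
  have hp9 : p.natDegree < 9 := by rw [hdeg8]; norm_num
  have hcoef : ∀ a, p.coeff a = if a = 0 then 1679616 else if a = 2 then -1166400 else if a = 4 then -1131408
      else if a = 6 then -1093500 else if a = 8 then 1679616 else 0 := coeff_cancellationWitness
  have hπ : ∀ a, |p.coeff a| ≤ 1679616 := by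
    intro a; rw [hcoef]; split_ifs <;> norm_num
  have hneg : ∀ a, p.coeff a < 0 → |p.coeff a| < 1679616 := by
    intro a ha
    rw [hcoef] at ha ⊢
    split_ifs at ha ⊢ <;> first | (norm_num; done) | (exfalso; norm_num at ha)
  -- coefficients of `Q`
  have hQ0 : Q.coeff 0 = 1679616 ^ (cst + 1) := by
    rw [hQ_def, iterate_coeff_zero p hp9, hcoef]; norm_num
  have hQlc : Q.leadingCoeff = 1679616 ^ (cst + 1) := by
    rw [hQ_def, iterate_leadingCoeff p, hlc8]
  have hQne : Q ≠ 0 := by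
    rw [Ne, ← leadingCoeff_eq_zero, hQlc]; positivity
  have hQneg : ∀ k, Q.coeff k < 0 → |Q.coeff k| < 1679616 ^ (cst + 1) := fun k hk =>
    iterate_neg_coeff_lt p hp9 1679616 hπ hneg (cst + 1) k hk
  -- the two positive zeros of `p`
  have hev : ∀ x : ℝ, p.eval x = 1679616 - 1166400 * x ^ 2 - 1131408 * x ^ 4 - 1093500 * x ^ 6 + 1679616 * x ^ 8 := by
    intro x; simp [hp_def, eval_add, eval_sub, eval_mul, eval_pow, eval_C, eval_X]
  have hcont : Continuous fun x : ℝ => p.eval x := p.continuous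
  obtain ⟨ρ₁, ⟨hρ₁a, hρ₁b⟩, hρ₁⟩ : ∃ ρ ∈ Set.Ioo (1 / 2 : ℝ) 1, p.eval ρ = 0 := by
    have h := intermediate_value_Ioo' (show (1 / 2 : ℝ) ≤ 1 by norm_num) hcont.continuousOn
    have h0 : (0 : ℝ) ∈ Set.Ioo (p.eval 1) (p.eval (1 / 2)) := by rw [hev, hev]; constructor <;> norm_num
    exact h h0
  obtain ⟨ρ₂, ⟨hρ₂a, hρ₂b⟩, hρ₂⟩ : ∃ ρ ∈ Set.Ioo (1 : ℝ) 2, p.eval ρ = 0 := by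
    have h := intermediate_value_Ioo (show (1 : ℝ) ≤ 2 by norm_num) hcont.continuousOn
    have h0 : (0 : ℝ) ∈ Set.Ioo (p.eval 1) (p.eval 2) := by rw [hev, hev]; constructor <;> norm_num
    exact h h0
  have hρ₁pos : 0 < ρ₁ := by linarith
  have hρ₂pos : 0 < ρ₂ := by linarith
  -- the `2 (cst + 1)` distinct positive zeros `ρ_a ^ (9^{-i})` of `Q`
  let ρ : Fin 2 → ℝ := fun a => if a = 0 then ρ₁ else ρ₂
  have hρ0 : ρ 0 = ρ₁ := if_pos rfl
  have hρ1 : ρ 1 = ρ₂ := if_neg (by decide)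
  have hρpos : ∀ a, 0 < ρ a := by
    intro a; fin_cases a
    · exact hρ0 ▸ hρ₁pos
    · exact hρ1 ▸ hρ₂pos
  have hρroot : ∀ a, p.eval (ρ a) = 0 := by
    intro a; fin_cases a
    · exact hρ0 ▸ hρ₁
    · exact hρ1 ▸ hρ₂
  let g : Fin (cst + 1) × Fin 2 → ℝ := fun ia => (ρ ia.2) ^ ((1 / 9 : ℝ) ^ (ia.1 : ℕ))
  have hg_eq : ∀ (i : Fin (cst + 1)) (a : Fin 2), g (i, a) = (ρ a) ^ ((1 / 9 : ℝ) ^ (i : ℕ)) := fun _ _ => rfl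
  have hgpos : ∀ ia, 0 < g ia := fun ia => Real.rpow_pos_of_pos (hρpos _) _
  have hgroot : ∀ ia, Q.eval (g ia) = 0 := by
    rintro ⟨i, a⟩
    refine iterate_eval_eq_zero p (cst + 1) _ ⟨i, i.isLt, ?_⟩
    have : (g (i, a)) ^ (9 ^ (i : ℕ)) = ρ a := by
      rw [hg_eq, ← Real.rpow_natCast, ← Real.rpow_mul (hρpos a).le]
      have : (1 / 9 : ℝ) ^ (i : ℕ) * ((9 ^ (i : ℕ) : ℕ) : ℝ) = 1 := by
        rw [Nat.cast_pow, Nat.cast_ofNat, ← mul_pow]; norm_num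
      rw [this, Real.rpow_one]
    rw [this]; exact hρroot a
  have hglt : ∀ i : Fin (cst + 1), g (i, 0) < 1 := fun i => by
    rw [hg_eq, hρ0]; exact Real.rpow_lt_one hρ₁pos.le hρ₁b (by positivity)
  have hggt : ∀ i : Fin (cst + 1), 1 < g (i, 1) := fun i => by
    rw [hg_eq, hρ1]; exact Real.one_lt_rpow hρ₂a (by positivity)
  have hexp : ∀ {i j : Fin (cst + 1)}, (1 / 9 : ℝ) ^ (i : ℕ) = (1 / 9 : ℝ) ^ (j : ℕ) → i = j := fun h =>
    Fin.ext (pow_right_injective₀ (by norm_num) (by norm_num) h)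
  have hinj0 : ∀ i j : Fin (cst + 1), g (i, 0) = g (j, 0) → i = j := by
    intro i j h
    rw [hg_eq, hg_eq, hρ0] at h
    apply hexp
    by_contra hne
    rcases lt_or_gt_of_ne hne with hlt | hlt
    · exact absurd h (ne_of_gt (Real.rpow_lt_rpow_of_exponent_gt hρ₁pos hρ₁b hlt))
    · exact absurd h (ne_of_lt (Real.rpow_lt_rpow_of_exponent_gt hρ₁pos hρ₁b hlt))
  have hinj1 : ∀ i j : Fin (cst + 1), g (i, 1) = g (j, 1) → i = j := by
    intro i j h
    rw [hg_eq, hg_eq, hρ1] at h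
    apply hexp
    by_contra hne
    rcases lt_or_gt_of_ne hne with hlt | hlt
    · exact absurd h (ne_of_lt (Real.rpow_lt_rpow_of_exponent_lt hρ₂a hlt))
    · exact absurd h (ne_of_gt (Real.rpow_lt_rpow_of_exponent_lt hρ₂a hlt))
  have hginj : Function.Injective g := by
    rintro ⟨i, a⟩ ⟨j, b⟩ hab
    fin_cases a <;> fin_cases b
    · simp only [Fin.zero_eta, Fin.isValue] at hab ⊢
      rw [hinj0 i j hab]
    · exfalso
      have h1 := hglt i; have h2 := hggt j
      simp only [Fin.zero_eta, Fin.isValue, Fin.mk_one] at hab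
      linarith
    · exfalso
      have h1 := hggt i; have h2 := hglt j
      simp only [Fin.zero_eta, Fin.isValue, Fin.mk_one] at hab
      linarith
    · simp only [Fin.mk_one, Fin.isValue] at hab ⊢
      rw [hinj1 i j hab]
  have hcard : 2 * (cst + 1) ≤ (Q.roots.toFinset.filter (fun t : ℝ => 0 < t)).card := by
    have hsub : Finset.univ.image g ⊆ Q.roots.toFinset.filter (fun t : ℝ => 0 < t) := by
      intro x hx
      obtain ⟨ia, -, rfl⟩ := Finset.mem_image.mp hx
      rw [Finset.mem_filter, Multiset.mem_toFinset, mem_roots hQne]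
      exact ⟨hgroot ia, hgpos ia⟩
    calc 2 * (cst + 1) = (Finset.univ : Finset (Fin (cst + 1) × Fin 2)).card := by simp [mul_comm]
      _ = (Finset.univ.image g).card := (Finset.card_image_of_injective _ hginj).symm
      _ ≤ _ := Finset.card_le_card hsub
  -- apply the law
  have hchord : ∀ k : ℕ, Q.coeff k < 0 → |Q.coeff k| ^ Q.natDegree < Q.coeff 0 ^ (Q.natDegree - k) * Q.leadingCoeff ^ k := by
    intro k hk
    have hkD : k ≤ Q.natDegree := le_natDegree_of_ne_zero hk.ne
    have hk0 : k ≠ 0 := by rintro rfl; rw [hQ0] at hk; exact absurd hk (not_lt.mpr (by positivity))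
    have hDpos : Q.natDegree ≠ 0 := by omega
    rw [hQ0, hQlc, ← pow_add, Nat.sub_add_cancel hkD]
    exact pow_lt_pow_left₀ (hQneg k hk) (abs_nonneg _) hDpos
  have h := hlaw m c e hcs hes hband (by rw [hdet', hQ0]; positivity) (by rw [hdet', hQlc]; positivity)
    (by rw [hdet']; exact hchord)
  rw [hdet'] at h
  omega

end Summit.ValiantsHypothesis.ValiantsHypothesis.Theorems.KPlusLogSqLaw.TridiagonalSector
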